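import Literature.LinearAlgebra.TensorNetworks.Elimination
import HarnessLib

/-!
# Tensor tables: the list-level form of variable elimination that a machine executes

Companion to `Elimination.lean` (`TFactor`, `TFactor.mul/sumOut/prodList/elimVar/elimList`, the
invariant `Elim.Inv`). There a factor is a `Finset` scope with an entry FUNCTION; a machine stores a
rank-`r` tensor as Markov–Shi do (Def. 3.1: "an `m^k`-dimensional array of complex numbers"): an
ordered list of `r` index names and the flat list of its `B^r` entries, entry number `j` belonging
to the assignment whose value at the `i`-th name is the `i`-th base-`B` digit of `j`. This file is
that representation, over an arbitrary coefficient type `K` with explicitly given operations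
(`KOps K`: the machine's exact arithmetic, e.g. `ℤ[ω]` by integer coordinates, is not a Mathlib
ring instance):

* `digit` (as in `PoweringConstruction.lean`'s `RotGraph.digit`, kept local to avoid a cross-topic
  import), `indexOf`, `assignOf` — base-`B` numerals of assignments along an ordered scope, with
  the round trip `assignOf_indexOf` and the range bound `indexOf_lt`;
* `KOps K`, `CTable Name K` (scope list + entry list), `CTable.evalAt` (`evalAt_congr`);
* the table operations `CTable.mulT`, `sumOutT`, `oneT`, `prodT`, `elimVarT`, `elimListT`, `valueT`
  — the literal programs of the contraction machine (only `List.range/map/foldr/filter/erase`,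
  mirrors of `TFactor.mul/sumOut/one/prodList/elimVar/elimList`), and the table sizes
  `length_entries_mulT` / `length_entries_sumOutT` (`B^{|scope|}` entries: Prop. 3.6's `exp[O(d)]`),
  `length_scope_mulT_le`.

That these programs compute, through a map `φ : K → R` respecting the operations, exactly the
elimination of `Elimination.lean` is `TableRepresents.lean`.

## References

* [MarkovShi2008] I. L. Markov, Y. Shi, *Simulating quantum computation by contracting tensor
  networks*, SIAM J. Comput. 38 (2008) 963–981 (arXiv:quant-ph/0511069), §3 (Def. 3.1: tensors as
  `m^k`-dimensional arrays; eq. (1); Prop. 3.6: "the algorithm stores the tensors of each vertex …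
  computes the new tensor according to Equation (1) … This takes `exp[O(d)]` time").
  Read via `lit read paper:arxiv-quant-ph_0511069` (pp. 7–8).
-/

namespace Literature.LinearAlgebra.TensorNetworks

open Finset

/-! ### Base-`B` numerals of assignments -/

/-- The `i`-th base-`B` digit of `j`. [folklore] -/
def digit (B j i : ℕ) : ℕ := j / B ^ i % B

/-- The digits of `j / B` are the digits of `j`, shifted. [folklore] -/
theorem digit_succ (B j i : ℕ) : digit B j (i + 1) = digit B (j / B) i := by
  simp [digit, Nat.pow_succ', Nat.div_div_eq_div_mul]

/-- The `0`-th digit. [folklore] -/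
@[simp] theorem digit_zero (B j : ℕ) : digit B j 0 = j % B := by simp [digit]

/-- **The number of an assignment** along an ordered scope (little-endian base `B`):
`indexOf B [v₀, v₁, …] g = g v₀ + B · (g v₁ + B · (…))`. [cite: MarkovShi2008, §3 (Def 3.1: an m^k-dimensional array indexed by k indices)] -/
def indexOf {Name : Type*} (B : ℕ) (sc : List Name) (g : Name → ℕ) : ℕ :=
  sc.foldr (fun v acc => g v + B * acc) 0

/-- `indexOf` of the empty scope. [folklore] -/
@[simp] theorem indexOf_nil {Name : Type*} (B : ℕ) (g : Name → ℕ) : indexOf B [] g = 0 := rfl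

/-- `indexOf` through a cons. [folklore] -/
@[simp] theorem indexOf_cons {Name : Type*} (B : ℕ) (v : Name) (sc : List Name) (g : Name → ℕ) :
    indexOf B (v :: sc) g = g v + B * indexOf B sc g := rfl

/-- `indexOf` depends only on the values on the scope. [folklore] -/
theorem indexOf_congr {Name : Type*} (B : ℕ) {sc : List Name} {g g' : Name → ℕ}
    (h : ∀ v ∈ sc, g v = g' v) : indexOf B sc g = indexOf B sc g' := by
  induction sc with
  | nil => rfl
  | cons v sc ih =>
    rw [indexOf_cons, indexOf_cons, h v List.mem_cons_self,
      ih fun u hu => h u (List.mem_cons_of_mem v hu)]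

/-- An assignment with values `< B` on the scope has number `< B^{|scope|}`. [folklore] -/
theorem indexOf_lt {Name : Type*} {B : ℕ} {sc : List Name} {g : Name → ℕ} (h : ∀ v ∈ sc, g v < B) :
    indexOf B sc g < B ^ sc.length := by
  induction sc with
  | nil => simp
  | cons v sc ih =>
    rw [indexOf_cons, List.length_cons, Nat.pow_succ]
    have h1 := h v List.mem_cons_self
    have h2 := ih fun u hu => h u (List.mem_cons_of_mem v hu)
    have h3 : B * indexOf B sc g + B ≤ B * B ^ sc.length := by
      rw [← Nat.mul_succ]; exact Nat.mul_le_mul_left B h2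
    calc g v + B * indexOf B sc g < B + B * indexOf B sc g := Nat.add_lt_add_right h1 _
      _ = B * indexOf B sc g + B := Nat.add_comm _ _
      _ ≤ B * B ^ sc.length := h3
      _ = B ^ sc.length * B := Nat.mul_comm _ _

/-- **The assignment numbered `j`** along an ordered scope: the name at position `i` gets the `i`-th
digit of `j` (names off the scope get the digit past the end, irrelevant). [cite: MarkovShi2008, §3 (Def 3.1)] -/
def assignOf {Name : Type*} [DecidableEq Name] (B : ℕ) (sc : List Name) (j : ℕ) : Name → ℕ :=
  fun v => digit B j (sc.idxOf v)

/-- Values of `assignOf` are `< B`. [folklore] -/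
theorem assignOf_lt {Name : Type*} [DecidableEq Name] {B : ℕ} (hB : 0 < B) (sc : List Name) (j : ℕ)
    (v : Name) : assignOf B sc j v < B :=
  Nat.mod_lt _ hB

/-- `assignOf` at the head of the scope. [folklore] -/
theorem assignOf_cons_self {Name : Type*} [DecidableEq Name] (B : ℕ) (v : Name) (sc : List Name)
    (j : ℕ) : assignOf B (v :: sc) j v = j % B := by
  simp [assignOf]

/-- `assignOf` past the head of the scope. [folklore] -/
theorem assignOf_cons_of_ne {Name : Type*} [DecidableEq Name] (B : ℕ) {v u : Name} (h : u ≠ v)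
    (sc : List Name) (j : ℕ) : assignOf B (v :: sc) j u = assignOf B sc (j / B) u := by
  simp only [assignOf]
  rw [List.idxOf_cons_ne _ (Ne.symm h), digit_succ]

/-- **Round trip**: the assignment numbered `indexOf B sc g` agrees with `g` on a duplicate-free
scope on which `g < B`. [folklore] -/
theorem assignOf_indexOf {Name : Type*} [DecidableEq Name] {B : ℕ} :
    ∀ {sc : List Name}, sc.Nodup → ∀ {g : Name → ℕ}, (∀ v ∈ sc, g v < B) →
      ∀ v ∈ sc, assignOf B sc (indexOf B sc g) v = g v
  | [], _, _, _, v, hv => absurd hv List.not_mem_nil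
  | u :: sc, hnd, g, hg, v, hv => by
    rw [List.nodup_cons] at hnd
    have hB : 0 < B := Nat.pos_of_ne_zero fun h0 => by have := hg u List.mem_cons_self; omega
    rcases List.mem_cons.1 hv with rfl | hv'
    · rw [assignOf_cons_self, indexOf_cons, Nat.add_mul_mod_self_left,
        Nat.mod_eq_of_lt (hg v List.mem_cons_self)]
    · have hne : v ≠ u := fun h => hnd.1 (h ▸ hv')
      rw [assignOf_cons_of_ne B hne, indexOf_cons, Nat.add_mul_div_left _ _ hB,
        Nat.div_eq_of_lt (hg u List.mem_cons_self), zero_add]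
      exact assignOf_indexOf hnd.2 (fun w hw => hg w (List.mem_cons_of_mem u hw)) v hv'

/-! ### Tables and their operations -/

/-- The coefficient operations a machine implements exactly (e.g. `ℤ[ω]` by integer coordinates):
zero, one, sum and product — a bare record, no laws (the laws hold in the target ring through the
map `φ` of `Represents`). [folklore] -/
structure KOps (K : Type*) where
  /-- The zero coefficient. -/
  zero : K
  /-- The unit coefficient. -/
  one : K
  /-- Sum of coefficients. -/
  add : K → K → K
  /-- Product of coefficients. -/
  mul : K → K → K

/-- **A tensor table**: an ordered scope of index names and the flat list of entries, entry `j`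
belonging to the assignment `assignOf B scope j` (Markov–Shi Def. 3.1: a rank-`k` tensor as an
`m^k`-dimensional array). [cite: MarkovShi2008, §3 (Def 3.1)] -/
structure CTable (Name K : Type*) where
  /-- The index names, in the order used to number the entries. -/
  scope : List Name
  /-- The `B^{|scope|}` entries. -/
  entries : List K

namespace CTable

variable {Name K : Type*} [DecidableEq Name]

/-- The entry of a table at an assignment of naturals to names (entry number `indexOf`; the zero
coefficient past the end). [cite: MarkovShi2008, §3 (Def 3.1)] -/
def evalAt (ops : KOps K) (B : ℕ) (t : CTable Name K) (g : Name → ℕ) : K :=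
  t.entries.getD (indexOf B t.scope g) ops.zero

omit [DecidableEq Name] in
/-- The entry at an assignment depends only on its values on the scope. [folklore] -/
theorem evalAt_congr (ops : KOps K) (B : ℕ) (t : CTable Name K) {g g' : Name → ℕ}
    (h : ∀ v ∈ t.scope, g v = g' v) : t.evalAt ops B g = t.evalAt ops B g' := by
  rw [evalAt, evalAt, indexOf_congr B h]

/-- The union of two ordered scopes: the first, then the new names of the second. [folklore] -/
def unionScope (s t : List Name) : List Name := s ++ t.filter fun v => v ∉ s

/-- **Product of tables** (the merged tensor of Markov–Shi eq. (1) before summation): scope the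
union, entry `j` the product of the two entries at the assignment numbered `j`.
[cite: MarkovShi2008, §3 (eq. (1))] -/
def mulT (ops : KOps K) (B : ℕ) (s t : CTable Name K) : CTable Name K :=
  ⟨unionScope s.scope t.scope,
    (List.range (B ^ (unionScope s.scope t.scope).length)).map fun j =>
      ops.mul (s.evalAt ops B (assignOf B (unionScope s.scope t.scope) j))
        (t.evalAt ops B (assignOf B (unionScope s.scope t.scope) j))⟩

/-- **Summing an index out of a table** (the contraction of Markov–Shi eq. (1)): scope `erase v`,
entry `j` the sum over the `B` values of `v` of the entries at the assignment numbered `j` so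
extended. [cite: MarkovShi2008, §3 (eq. (1))] -/
def sumOutT (ops : KOps K) (B : ℕ) (v : Name) (t : CTable Name K) : CTable Name K :=
  ⟨t.scope.erase v,
    (List.range (B ^ (t.scope.erase v).length)).map fun j =>
      ((List.range B).map fun d =>
        t.evalAt ops B (Function.update (assignOf B (t.scope.erase v) j) v d)).foldr ops.add ops.zero⟩

/-- The unit table: empty scope, single entry `1`. [folklore] -/
def oneT (ops : KOps K) : CTable Name K := ⟨[], [ops.one]⟩

/-- Product of a list of tables. [folklore] -/
def prodT (ops : KOps K) (B : ℕ) (l : List (CTable Name K)) : CTable Name K :=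
  l.foldr (mulT ops B) (oneT ops)

/-- **One elimination step on tables** (mirror of `TFactor.elimVar`). [cite: MarkovShi2008, §3 (Prop 3.6)] -/
def elimVarT (ops : KOps K) (B : ℕ) (v : Name) (pool : List (CTable Name K)) : List (CTable Name K) :=
  sumOutT ops B v (prodT ops B (pool.filter fun t => v ∈ t.scope)) ::
    pool.filter fun t => v ∉ t.scope

/-- **Elimination along an ordering on tables** (mirror of `TFactor.elimList`). [cite: MarkovShi2008, §4 (Def 4.1)] -/
def elimListT (ops : KOps K) (B : ℕ) (l : List Name) (pool : List (CTable Name K)) : List (CTable Name K) :=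
  l.foldl (fun p v => elimVarT ops B v p) pool

/-- The product of the entries number `0` of a pool (its value once all scopes are empty).
[cite: MarkovShi2008, §3 (Prop 3.5: the final rank-0 tensor)] -/
def valueT (ops : KOps K) (B : ℕ) (pool : List (CTable Name K)) : K :=
  (pool.map fun t => t.evalAt ops B fun _ => 0).foldr ops.mul ops.one

/-- `elimListT` through a cons. [folklore] -/
@[simp] theorem elimListT_cons (ops : KOps K) (B : ℕ) (v : Name) (l : List Name) (pool : List (CTable Name K)) :
    elimListT ops B (v :: l) pool = elimListT ops B l (elimVarT ops B v pool) := rfl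

/-- `elimListT` of the empty ordering. [folklore] -/
@[simp] theorem elimListT_nil (ops : KOps K) (B : ℕ) (pool : List (CTable Name K)) :
    elimListT ops B [] pool = pool := rfl

/-- **Size of a product table**: `B^{|union scope|}` entries. [cite: MarkovShi2008, §3 (Prop 3.6: exp(O(d)) per step)] -/
@[simp] theorem length_entries_mulT (ops : KOps K) (B : ℕ) (s t : CTable Name K) :
    (mulT ops B s t).entries.length = B ^ (mulT ops B s t).scope.length := by
  simp [mulT]

/-- **Size of a contracted table**: `B^{|scope| - 1}` entries. [cite: MarkovShi2008, §3 (Prop 3.6)] -/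
@[simp] theorem length_entries_sumOutT (ops : KOps K) (B : ℕ) (v : Name) (t : CTable Name K) :
    (sumOutT ops B v t).entries.length = B ^ (sumOutT ops B v t).scope.length := by
  simp [sumOutT]

/-- The scope of a product is at most as long as both scopes together. [folklore] -/
theorem length_scope_mulT_le (ops : KOps K) (B : ℕ) (s t : CTable Name K) :
    (mulT ops B s t).scope.length ≤ s.scope.length + t.scope.length := by
  simp only [mulT, unionScope, List.length_append]
  exact Nat.add_le_add_left (List.length_filter_le _ _) _

end CTable

end Literature.LinearAlgebra.TensorNetworks
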